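import Mathlib
import Summits.Ventures.HodgeRepro.Tier4.Common.AdelicDefs
import Summits.Ventures.HodgeRepro.Tier4.Common.MixedPlaneCusp
import Summits.Ventures.HodgeRepro.Tier4.Line1.PlaneDefs

/-!
# Tier 4 — Literature: the compactness criterion AT THE PLANE, anisotropic case (the sibling of
`LitCompactness.BorelHarishChandra1962_Thm11_8_cocompact_hdef`), seat t4-lit-3

Blind re-derivation cell `pub-hodge-repro`, Tier-4 literature seat `t4-lit-3` (gen 1; README §9–§10).  Target tree path
`lean/Summits/Ventures/HodgeRepro/Tier4/LitCompactnessPlane.lean`; HOME copy `lit/t4/LitCompactnessPlane.lean`.  Asked by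
t4-plan-4 g3 (STATUS S14625, cut C-L4-ANISO-SETTING (a)): «the anisotropic-INDEFINITE twin of
`Lit.BorelHarishChandra1962_Thm11_8_cocompact_hdef` at the PLANE … the existing `_hdef` Prop's sibling with `IsDefinite`
replaced by anisotropy of the plane».  A NEW module (not an append to `LitCompactness.lean`, whose importers
`Common/{CocompactDomain, FundamentalDomain, PartitionFunction, ProperlyDiscontinuous}` would make the plane vocabulary
an import cycle).  Statement only; NO proof of any published theorem; the one `theorem` is pure glue on the definitions.

THE PRINT (the cell's rows, proofs/t4/inputs/): the compactness criterion for arithmetic / adelic quotients —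
Borel–Harish-Chandra, «Arithmetic subgroups of algebraic groups», Ann. of Math. 75 (1962) 485–535, Theorem 11.8 (Godement's
criterion; the journal print is NOT held — WANTED W42, cite-only), read on the held prints: (i) Borel, «Some finiteness
properties of adele groups over number fields», Publ. Math. IHÉS 16 (1963), NUMDAM print, **Theorem 5.6 (ii): «G_A/G_k is
compact if and only if X_k(G°) = 1 and every unipotent element of G_k belongs to the radical of G_k»** (lit-1's row
I-t4-lit-1-36, p0002:L29–L36 — the ADELIC form typed here); (ii) Witte Morris, «Introduction to arithmetic groups»
(arXiv:math/0106063, held), Proposition 183 / Theorem 184 (row I-t4-lit-3-26, p0046: «compact if and only if … no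
nontrivial unipotent elements»); (iii) Borel–Wallach, Continuous cohomology, 2nd ed., Ch. VIII §5 (row I-t4-lit-3-37: the
cocompactness for unitary groups definite at the other real places).

WHAT IS BUILT INTO THE TYPING (README §9; the same reading as rows 26–28 / E1 for the `_hdef` Prop).  The plane is
typer-2's `PlaneData k` with the adelic unitary group `unitaryGroup W = {g ∈ GL₄(𝔸_k) | g Ω = Ω g ∧ g B gᵀ = B}` (ROW
convention, `Common/AdelicDefs`) and its rational points `rationalPoints W` (the principal elements); `IsGenuineRow W`
(`Line1/PlaneDefs` v0.2) says the data encode a genuine `E′`-hermitian plane `h` (`Ω² = −d`, `−d` not a square,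
`Ω B = −B Ωᵀ`, …), so that `unitaryGroup W` is the group of adelic points of the algebraic `k`-group `U(h)`;
`IsAnisotropic W` (`Common/MixedPlaneCusp`: the trace form `B` has no non-zero isotropic vector over `k`, i.e. `h` has none,
since `B(ℓ, ℓ) = 2 h(ℓ, ℓ)`) is the `k`-ANISOTROPY of `U(h)` (its `k`-rank is the Witt index of `h`); `X_k(U(h)) = 1`
holds for every hermitian `h` (the only characters factor through `det : U(h) → U(1) = E′¹`, a `k`-anisotropic torus) and
is NOT a displayed hypothesis.  Under these readings the print's «if» direction specialises to the conclusion typed: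
`U(h)(𝔸_k) = U(h)(k) · C` for a compact `C` — the very shape of L1's DEFINITE theorem `Line1.cocompact_rationalPoints`
(t4-L1-p5, QuotientCompact.lean: `∃ C : Set (GA W), IsCompact C ∧ ∀ g, ∃ γ : rationalPoints W, ∃ c ∈ C, g = γ * c`),
which the glue theorem `isAnisotropic_of_isDefinite` shows to be the SPECIAL CASE «definite at some real place» of this
Prop's hypothesis (a definite form is anisotropic).  The «only if» direction (an ISOTROPIC plane, i.e. the quasi-split
`U(1,1)`, has a NON-compact quotient — crit-2 S13917's shape) is NOT typed here: plan-4's S14625 declares the isotropic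
faces a residual, nobody displays it; say the shape and it is appended.

Nothing here says anything about the status of the Hodge conjecture for CM abelian varieties, which is NOT proved;
HC_CM is NOT proved by anyone in this repository.
-/

set_option autoImplicit false

noncomputable section

namespace Summit.Ventures.HodgeRepro.Tier4.Lit

open Matrix Summit.Ventures.HodgeRepro.Tier4.Common Summit.Ventures.HodgeRepro.Tier4.Line1

variable {k : Type} [Field k] [NumberField k]

/-- **The compactness criterion at the PLANE, anisotropic case — AS READ from the held prints** (Borel 1963 Thm 5.6 (ii),
Borel–Harish-Chandra 1962 Thm 11.8 / Godement; rows I-t4-lit-1-36, I-t4-lit-3-26 and -28): for a genuine hermitian plane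
(`IsGenuineRow W`) that is `k`-anisotropic (`IsAnisotropic W`, no isotropic vector), the rational points of its unitary
group are cocompact in the adelic points — `U(h)(𝔸_k) = U(h)(k) · C` for some compact `C ⊆ U(h)(𝔸_k)`.  The sibling of
`BorelHarishChandra1962_Thm11_8_cocompact_hdef` (the 3-variable ball-action form) with `IsDefinite` replaced by
anisotropy; the conclusion is byte-for-byte the conclusion of L1's definite theorem `Line1.cocompact_rationalPoints`. -/
def BorelHarishChandra1962_Thm11_8_cocompact_plane_aniso (W : PlaneData k) : Prop :=
  IsGenuineRow W → IsAnisotropic W →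
    ∃ C : Set (GA W), IsCompact C ∧ ∀ g : GA W, ∃ γ : rationalPoints W, ∃ c ∈ C, g = (γ : GA W) * c

omit [NumberField k] in
/-- **Glue (no published content): a plane definite at some real place is anisotropic.**  If `B.map σ` (or its negative)
is positive definite for a real embedding `σ`, then `ℓ ⬝ᵥ (B *ᵥ ℓ) ≠ 0` for every non-zero rational `ℓ`, because
`σ (ℓ ⬝ᵥ (B *ᵥ ℓ)) = (ℓ.map σ) ⬝ᵥ ((B.map σ) *ᵥ (ℓ.map σ))` is non-zero.  Hence the hypothesis class of
`BorelHarishChandra1962_Thm11_8_cocompact_plane_aniso` contains L1's definite planes. -/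
theorem isAnisotropic_of_isDefinite (W : PlaneData k) (hW : IsDefinite W) : IsAnisotropic W := by
  rintro ⟨ℓ, hℓ, hiso⟩
  obtain ⟨σ, hσ⟩ := hW
  -- the image of the rational vector under the real embedding, and the transported quadratic value
  have hcomp : σ ∘ (W.B *ᵥ ℓ) = (W.B.map σ) *ᵥ (σ ∘ ℓ) := by
    funext i
    exact RingHom.map_mulVec σ W.B ℓ i
  have hmap : (σ ∘ ℓ) ⬝ᵥ ((W.B.map σ) *ᵥ (σ ∘ ℓ)) = σ (ℓ ⬝ᵥ (W.B *ᵥ ℓ)) := by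
    rw [RingHom.map_dotProduct σ ℓ (W.B *ᵥ ℓ), hcomp]
  have hzero : (σ ∘ ℓ) ⬝ᵥ ((W.B.map σ) *ᵥ (σ ∘ ℓ)) = 0 := by
    rw [hmap, hiso, map_zero]
  have hne : σ ∘ ℓ ≠ 0 := by
    intro h0
    apply hℓ
    funext i
    have h1 : σ (ℓ i) = 0 := congrFun h0 i
    exact (map_eq_zero σ).mp h1
  rcases hσ with hpos | hneg
  · have := hpos.dotProduct_mulVec_pos hne
    rw [star_trivial, hzero] at this
    exact lt_irrefl _ this
  · have := hneg.dotProduct_mulVec_pos hne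
    rw [star_trivial, Matrix.neg_mulVec, dotProduct_neg, hzero, neg_zero] at this
    exact lt_irrefl _ this

end Summit.Ventures.HodgeRepro.Tier4.Lit
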